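import Summits.CriticalPhenomena.SAWScalingLimit.Theorems.SAWRenewalTightnessTubeLowerBoundMirrorPin
import Mathlib.Algebra.Order.Chebyshev

/-!
# Crux `TubeLowerBound` (stmt-CriticalPhenomena-4730), line `bridge-doubling-tower`: stub S2 `stub_doublingUpgrade`

Wedge-slab floor ⇒ pointwise diamond-piece floor: Madras–Slade's reflect-and-Schwarz (N. Madras, G. Slade,
*The Self-Avoiding Walk* (1993), Lemma 4.1.12, p. 85) applied once to the wedge-bridge family.  For
`s = 2l + 1 + ε` (`ε ∈ {0,1}`, `l ≥ 1`) glue a wedge bridge `ω` of span `l` (a self-avoiding walk from `0` in the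
start wedge `|y| < x ≤ l` at times `≥ 1` and in the tube `5|y| ≤ l`, ending on the column `x = l`) with end
height `y`, the `1 + ε` bridging east steps, and the time-reversed mirror image under `x ↦ s − x` of a second
wedge bridge `ω'` with the same end height: a diamond piece `0 → (s, 0)` (interior points in both wedges
`|y| < x`, `|y| < s − x`, all points in the tube `10|y| ≤ s`), injectively in `(ω, ω')` (the halves live in the
columns `x ≤ l` and `x ≥ l + 1`).  Cauchy–Schwarz over the `≤ 2l + 1` end heights turns the point-to-line floor
`c l^{−C}` into the pointwise floor `(x_c² (min c 1)² / 4) s^{−(2C+1)}`; `s ∈ {1, 2}` is the straight walk.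
Only `0 < x_c ≤ 1` is used about `x_c`.  The generic gluing / pairing / arithmetic lemmas are those of
`SAWRenewalTightnessTubeLowerBoundMirrorPin.lean` (`LiebSimonStar.mirrorPin_glue_mem_sawFun`,
`mirrorPin_schwarz_pairing`, `mirrorPin_final_algebra`).  No new definitions: the two families, the east
extension and the gluing relation are local notations.
-/

noncomputable section

namespace Summit.CriticalPhenomena.SAWScalingLimit.Theorems.TubeLowerBound.BridgeDoublingTower

open scoped BigOperators Classical
open Literature.Probability.LatticeModels Literature.Probability.RandomPlanarGeometry
open Summit.CriticalPhenomena.SAWScalingLimit.Theorems.TubeLowerBound.LiebSimonStar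

set_option quotPrecheck false in
/-- `WF[l, n]`: the wedge-bridge family of the hypothesis at span `l` and length `n` — self-avoiding walks from
`0` ending on the column `x = l`, in the start wedge `|y| < x ≤ l` at times `1 ≤ i ≤ n`, in the tube `5|y| ≤ l`
at all times `≤ n`. -/
local notation "WF[" l ", " n "]" => Finset.filter (fun ω : ℕ → Site 2 =>
  ω n 0 = ((l : ℕ) : ℤ) ∧
    (∀ i : ℕ, 1 ≤ i → i ≤ n → |ω i 1| < ω i 0 ∧ ω i 0 ≤ ((l : ℕ) : ℤ)) ∧
    (∀ i ≤ n, 5 * |ω i 1| ≤ ((l : ℕ) : ℤ))) (SAW.Zd.saws 2 n)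

set_option quotPrecheck false in
/-- `DF[s, n]`: the diamond-piece family of the conclusion at span `s` and length `n` — self-avoiding walks
`0 → (s, 0)` whose points at times `1 ≤ i < n` lie in both wedges `|y| < x`, `|y| < s − x`, all points in the
tube `10|y| ≤ s`. -/
local notation "DF[" s ", " n "]" => Finset.filter (fun ω : ℕ → Site 2 =>
  ω n 0 = ((s : ℕ) : ℤ) ∧ ω n 1 = 0 ∧
    (∀ i : ℕ, 1 ≤ i → i < n → |ω i 1| < ω i 0 ∧ |ω i 1| < ((s : ℕ) : ℤ) - ω i 0) ∧
    (∀ i ≤ n, 10 * |ω i 1| ≤ ((s : ℕ) : ℤ))) (SAW.Zd.saws 2 n)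

/-- `EXT[ε, m, ω]`: the `m`-step walk `ω` followed by `ε` unit steps east. -/
local notation "EXT[" ε ", " m ", " ω "]" => SAW.Zd.concatWalk m ω (SAW.Zd.straightWalk 2 ε)

set_option quotPrecheck false in
/-- `Glues[L, p, q, h, t, γ]`: `γ` is the head `h` up to time `p`, then the mirror image under `x ↦ L − x`
(`SAW.Zd.reflAt 0 L`) of the tail `t` run backwards from time `q` to time `0` (the gluing relation of
`LiebSimonStar.mirrorPin_glue_mem_sawFun`). -/
local notation "Glues[" L ", " p ", " q ", " h ", " t ", " γ "]" =>
  ∀ i : ℕ, (γ : ℕ → Site 2) i = if i ≤ p then (h : ℕ → Site 2) i else SAW.Zd.reflAt 0 L (t (p + 1 + q - i))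

/-! ### Wedge bridges and their east extension -/

/-- A wedge bridge of length `m` is frozen from time `m` on. -/
theorem doubling_wedge_frozen {l m : ℕ} {ω : ℕ → Site 2} (hω : ω ∈ WF[l, m]) : ∀ i, m ≤ i → ω i = ω m :=
  (SAW.Zd.mem_saws.1 (Finset.mem_filter.1 hω).1).2.1

/-- The columns of a wedge bridge of span `l` lie in `[0, l]` and its heights satisfy `5|y| ≤ l`. -/
theorem doubling_wedge_box {l m : ℕ} {ω : ℕ → Site 2} (hω : ω ∈ WF[l, m]) :
    ∀ i ≤ m, 0 ≤ ω i 0 ∧ ω i 0 ≤ (l : ℤ) ∧ 5 * |ω i 1| ≤ (l : ℤ) := by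
  obtain ⟨hωs, -, hw, ht⟩ := Finset.mem_filter.1 hω
  intro i hi
  rcases Nat.eq_zero_or_pos i with rfl | hi1
  · have h0 : ω 0 = 0 := (SAW.Zd.mem_saws.1 hωs).1
    exact ⟨by simp [h0], by simp [h0], ht 0 hi⟩
  · have h := hw i hi1 hi
    have habs := abs_nonneg (ω i 1)
    exact ⟨by omega, h.2, ht i hi⟩

/-- From time `m` on the east extension of a wedge bridge of span `l` is on the column `l + min (i − m) ε` at
the end height of `ω`. -/
theorem doubling_ext_key {l ε m : ℕ} {ω : ℕ → Site 2} (hω : ω ∈ WF[l, m]) {i : ℕ} (hi : m ≤ i) :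
    EXT[ε, m, ω] i 0 = (l : ℤ) + ((min (i - m) ε : ℕ) : ℤ) ∧ EXT[ε, m, ω] i 1 = ω m 1 := by
  have hend : ω m 0 = (l : ℤ) := (Finset.mem_filter.1 hω).2.1
  rw [mirrorPin_ext_apply_of_ge hi]
  simp [hend]

/-- The east extension of a wedge bridge: a self-avoiding walk of length `m + ε` in the columns `[0, l + ε]`
with the heights of `ω` (so `5|y| ≤ l`), ending at `(l + ε, ω m 1)`. -/
theorem doubling_ext_spec {l ε m : ℕ} {ω : ℕ → Site 2} (hω : ω ∈ WF[l, m]) :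
    EXT[ε, m, ω] ∈ SAW.Zd.saws 2 (m + ε) ∧
    (∀ i ≤ m + ε, 0 ≤ EXT[ε, m, ω] i 0 ∧ EXT[ε, m, ω] i 0 ≤ (l : ℤ) + ε ∧
      5 * |EXT[ε, m, ω] i 1| ≤ (l : ℤ)) ∧
    EXT[ε, m, ω] (m + ε) 0 = (l : ℤ) + ε ∧ EXT[ε, m, ω] (m + ε) 1 = ω m 1 := by
  obtain ⟨hωs, hend, -, -⟩ := Finset.mem_filter.1 hω
  have hbox := doubling_wedge_box hω
  refine ⟨?_, fun i hi => ?_, ?_, (doubling_ext_key (ε := ε) hω (Nat.le_add_right m ε)).2⟩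
  · refine SAW.Zd.concatWalk_mem_saws hωs (SAW.Zd.straightWalk_mem_saws 2 ε) fun i hi j hj1 hjε e => ?_
    have e0 := congrFun e 0
    simp only [Pi.add_apply, SAW.Zd.straightWalk, Pi.single_eq_same, min_eq_left hjε, hend] at e0
    have := (hbox i hi).2.1
    omega
  · rcases le_or_gt i m with him | him
    · rw [mirrorPin_ext_apply_of_le him]
      obtain ⟨h1, h2, h3⟩ := hbox i him
      exact ⟨h1, by omega, h3⟩
    · obtain ⟨e0, e1⟩ := doubling_ext_key (ε := ε) hω him.le
      rw [e0, e1]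
      have hmin : (min (i - m) ε : ℕ) ≤ ε := min_le_right _ _
      obtain ⟨-, -, h3⟩ := hbox m le_rfl
      exact ⟨by positivity, by omega, h3⟩
  · rw [(doubling_ext_key (ε := ε) hω (Nat.le_add_right m ε)).1]
    simp

/-! ### The glued walk of a pair and its decoding -/

/-- **The glued walk is a diamond piece.** For wedge bridges `ω`, `ω'` of span `l` with the same end height and
`L = 2l + 1 + ε`, the glued walk (`ω`, the `1 + ε` bridging east steps, the reversed mirror image of `ω'`) is a
self-avoiding walk `0 → (L, 0)` of length `m + 1 + (m' + ε)` whose points at times `1 ≤ i < m + 1 + (m' + ε)`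
lie in both open wedges `|y| < x`, `|y| < L − x` (the start wedge of `ω'` becomes the end wedge; the halves live
in the columns `x ≤ l` and `x ≥ l + 1`) and all of whose points satisfy `10|y| ≤ L` (from `5|y| ≤ l`). -/
theorem doubling_pin_mem {l ε L m m' : ℕ} (hL : L = 2 * l + 1 + ε) {ω ω' γ : ℕ → Site 2}
    (hγ : Glues[L, m, m' + ε, ω, EXT[ε, m', ω'], γ]) (hω : ω ∈ WF[l, m]) (hω' : ω' ∈ WF[l, m'])
    (hy : ω m 1 = ω' m' 1) : γ ∈ DF[L, m + 1 + (m' + ε)] := by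
  obtain ⟨ht, tbox, tend0, tend1⟩ := doubling_ext_spec (ε := ε) hω'
  obtain ⟨hωs, hend, hw, -⟩ := Finset.mem_filter.1 hω
  have hbox := doubling_wedge_box hω
  have hw' := (Finset.mem_filter.1 hω').2.2.1
  have hLz : (L : ℤ) = 2 * l + 1 + ε := by rw [hL]; push_cast; ring
  have hsaw : γ ∈ SAW.Zd.sawFun 2 (m + 1 + (m' + ε)) ![(L : ℤ), 0] := by
    refine mirrorPin_glue_mem_sawFun hγ hωs ht ?_ ?_
    · rw [SAW.Zd.zdGraph_adj_iff_sub]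
      refine ⟨0, Or.inl ?_⟩
      funext j
      fin_cases j
      · simp [hend, tend0, hLz]
        ring
      · simp [hy, tend1]
    · intro i hi j hj
      have := (hbox i hi).2.1
      have := (tbox j hj).2.1
      omega
  obtain ⟨hγs, hγn⟩ := SAW.Zd.mem_sawFun_iff_mem_saws.1 hsaw
  rw [Finset.mem_filter]
  refine ⟨hγs, by simp [hγn], by simp [hγn], fun i h1i hin => ?_, fun i hi => ?_⟩
  · rcases le_or_gt i m with him | him
    · rw [mirrorPin_glue_apply_of_le hγ him]
      obtain ⟨h1, h2⟩ := hw i h1i him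
      exact ⟨h1, by omega⟩
    · rw [mirrorPin_glue_apply_of_lt hγ him, SAW.Zd.reflAt_apply_same,
        SAW.Zd.reflAt_apply_of_ne (show (1 : Fin 2) ≠ 0 by decide)]
      rcases le_or_gt (m + 1 + (m' + ε) - i) m' with hj | hj
      · rw [mirrorPin_ext_apply_of_le hj]
        obtain ⟨h1, h2⟩ := hw' (m + 1 + (m' + ε) - i) (by omega) hj
        exact ⟨by omega, by omega⟩
      · obtain ⟨e0, e1⟩ := doubling_ext_key (ε := ε) hω' hj.le
        rw [e0, e1]
        have hk1 : 1 ≤ min (m + 1 + (m' + ε) - i - m') ε := le_min (by omega) (by omega)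
        have hk2 : min (m + 1 + (m' + ε) - i - m') ε ≤ ε := min_le_right _ _
        obtain ⟨-, -, h3⟩ := doubling_wedge_box hω' m' le_rfl
        have habs := abs_nonneg (ω' m' 1)
        exact ⟨by omega, by omega⟩
  · rcases le_or_gt i m with him | him
    · rw [mirrorPin_glue_apply_of_le hγ him]
      have := (hbox i him).2.2
      omega
    · rw [mirrorPin_glue_apply_of_lt hγ him, SAW.Zd.reflAt_apply_of_ne (show (1 : Fin 2) ≠ 0 by decide)]
      have := (tbox (m + 1 + (m' + ε) - i) (by omega)).2.2
      omega

/-- **Column decoding of the head length.** A glued walk with head length `m` is in the columns `x ≤ l` up to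
time `m` and on the column `x = l + 1` at time `m + 1`; so it is not a glued walk (for any data) with a larger
head length `n` over a wedge bridge of span `l`. -/
theorem doubling_pin_not_lt {l ε L m m' n q : ℕ} (hL : L = 2 * l + 1 + ε) {ω ω' ν t γ δ : ℕ → Site 2}
    (hγ : Glues[L, m, m' + ε, ω, EXT[ε, m', ω'], γ]) (hδ : Glues[L, n, q, ν, t, δ])
    (hω' : ω' ∈ WF[l, m']) (hν : ν ∈ WF[l, n]) (he : γ = δ) : ¬ m < n := fun hlt => by
  have a := congrFun (congrFun he (m + 1)) 0
  rw [mirrorPin_glue_apply_of_lt hγ (Nat.lt_succ_self m), SAW.Zd.reflAt_apply_same,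
    show m + 1 + (m' + ε) - (m + 1) = m' + ε by omega, (doubling_ext_spec hω').2.2.1, hL,
    mirrorPin_glue_apply_of_le hδ (show m + 1 ≤ n by omega)] at a
  have b := ((Finset.mem_filter.1 hν).2.2.1 (m + 1) (by omega) (by omega)).2
  push_cast at a
  omega

/-- **Decoding.** Two pairs of wedge bridges of span `l` with the same total length and the same glued walk are
equal: the head length is the last time before the column `x = l + 1` is reached, the head is read off directly
and the tail through the involution `reflAt 0 L`. -/
theorem doubling_pin_decode {l ε L m₁ m₁' m₂ m₂' : ℕ} (hL : L = 2 * l + 1 + ε)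
    {ω₁ ω₁' ω₂ ω₂' γ₁ γ₂ : ℕ → Site 2}
    (hγ₁ : Glues[L, m₁, m₁' + ε, ω₁, EXT[ε, m₁', ω₁'], γ₁])
    (hγ₂ : Glues[L, m₂, m₂' + ε, ω₂, EXT[ε, m₂', ω₂'], γ₂])
    (h₁ : ω₁ ∈ WF[l, m₁]) (h₁' : ω₁' ∈ WF[l, m₁']) (h₂ : ω₂ ∈ WF[l, m₂]) (h₂' : ω₂' ∈ WF[l, m₂'])
    (hn : m₁ + 1 + (m₁' + ε) = m₂ + 1 + (m₂' + ε)) (he : γ₁ = γ₂) :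
    m₁ = m₂ ∧ ω₁ = ω₂ ∧ m₁' = m₂' ∧ ω₁' = ω₂' := by
  obtain rfl : m₁ = m₂ := le_antisymm (Nat.le_of_not_lt (doubling_pin_not_lt hL hγ₂ hγ₁ h₂' h₁ he.symm))
    (Nat.le_of_not_lt (doubling_pin_not_lt hL hγ₁ hγ₂ h₁' h₂ he))
  obtain rfl : m₁' = m₂' := by omega
  have hh : ∀ i ≤ m₁, ω₁ i = ω₂ i := fun i hi => by
    have e := congrFun he i
    rwa [mirrorPin_glue_apply_of_le hγ₁ hi, mirrorPin_glue_apply_of_le hγ₂ hi] at e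
  have ht : ∀ j ≤ m₁', ω₁' j = ω₂' j := fun j hj => by
    have e := congrFun he (m₁ + 1 + (m₁' + ε) - j)
    rw [mirrorPin_glue_apply_of_lt hγ₁ (by omega), mirrorPin_glue_apply_of_lt hγ₂ (by omega),
      show m₁ + 1 + (m₁' + ε) - (m₁ + 1 + (m₁' + ε) - j) = j by omega,
      mirrorPin_ext_apply_of_le hj, mirrorPin_ext_apply_of_le hj] at e
    exact SAW.Zd.reflAt_injective 0 _ e
  refine ⟨rfl, funext fun i => ?_, rfl, funext fun j => ?_⟩
  · rcases le_or_gt i m₁ with hi | hi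
    · exact hh i hi
    · rw [doubling_wedge_frozen h₁ i hi.le, doubling_wedge_frozen h₂ i hi.le, hh m₁ le_rfl]
  · rcases le_or_gt j m₁' with hj | hj
    · exact ht j hj
    · rw [doubling_wedge_frozen h₁' j hj.le, doubling_wedge_frozen h₂' j hj.le, ht m₁' le_rfl]

/-! ### Reflect-and-Schwarz for the two families -/

/-- **The pairing bound**: with `L = 2l + 1 + ε`, `ε ≤ 1`,
`x_c^{1+ε} (Σ_{n ≤ N} Σ_{WF[l, n]} x_c^n)² ≤ (2l + 1) · Σ_{n ≤ 2N+2} Σ_{DF[L, n]} x_c^n`: pair wedge bridges of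
lengths `≤ N` with the same end height `y ∈ [−l, l]`, glue (a diamond piece of length `≤ 2N + 2` and weight
`x_c^{1+ε} · x_c^m x_c^{m'}`, injectively), and Cauchy–Schwarz over the `2l + 1` heights
(`LiebSimonStar.mirrorPin_schwarz_pairing`). -/
theorem doubling_mass_pairing {l ε L : ℕ} (hε : ε ≤ 1) (hL : L = 2 * l + 1 + ε) (N : ℕ) :
    SAW.criticalFugacity ^ (ε + 1) *
        (∑ n ∈ Finset.range (N + 1), ∑ _ω ∈ WF[l, n], SAW.criticalFugacity ^ n) ^ 2 ≤
      (2 * (l : ℝ) + 1) *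
        ∑ n ∈ Finset.range (2 * N + 2 + 1), ∑ _ω ∈ DF[L, n], SAW.criticalFugacity ^ n := by
  have hY : ((Finset.Icc (-(l : ℤ)) l).card : ℝ) = 2 * l + 1 := by
    rw [Int.card_Icc, show (l : ℤ) + 1 - -(l : ℤ) = ((2 * l + 1 : ℕ) : ℤ) by push_cast; ring,
      Int.toNat_natCast]
    push_cast
    ring
  rw [Finset.sum_sigma', Finset.sum_sigma', ← hY]
  refine mirrorPin_schwarz_pairing _ _ (Finset.Icc (-(l : ℤ)) l)
    (fun p : (Σ _ : ℕ, ℕ → Site 2) => p.2 p.1 1) _ _ _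
    (fun p p' : (Σ _ : ℕ, ℕ → Site 2) => ⟨p.1 + 1 + (p'.1 + ε), fun i => if i ≤ p.1 then p.2 i else
      SAW.Zd.reflAt 0 L (EXT[ε, p'.1, p'.2] (p.1 + 1 + (p'.1 + ε) - i))⟩)
    (pow_nonneg SAW.criticalFugacity_pos.le _) ?_ (fun q _ => pow_nonneg SAW.criticalFugacity_pos.le _)
    ?_ ?_
  · rintro ⟨m, ω⟩ hp
    have h5 : 5 * |ω m 1| ≤ (l : ℤ) := (doubling_wedge_box (Finset.mem_sigma.1 hp).2 m le_rfl).2.2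
    have h6 := le_abs_self (ω m 1)
    have h7 := neg_abs_le (ω m 1)
    simp only [Finset.mem_Icc]
    exact ⟨by omega, by omega⟩
  · rintro ⟨m, ω⟩ hp ⟨m', ω'⟩ hp' hy
    simp only [Finset.mem_sigma, Finset.mem_range] at hp hp' hy ⊢
    exact ⟨⟨by omega, doubling_pin_mem hL (fun _ => rfl) hp.2 hp'.2 hy⟩, le_of_eq (by ring)⟩
  · rintro ⟨m₁, ω₁⟩ h₁ ⟨m₁', ω₁'⟩ h₁' ⟨m₂, ω₂⟩ h₂ ⟨m₂', ω₂'⟩ h₂' - - he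
    obtain ⟨hn, hγ⟩ := Sigma.mk.inj_iff.1 he
    obtain ⟨rfl, rfl, rfl, rfl⟩ := doubling_pin_decode hL (fun _ => rfl) (fun _ => rfl)
      (Finset.mem_sigma.1 h₁).2 (Finset.mem_sigma.1 h₁').2 (Finset.mem_sigma.1 h₂).2
      (Finset.mem_sigma.1 h₂').2 hn (eq_of_heq hγ)
    exact ⟨rfl, rfl⟩

/-! ### The straight walk and the stub -/

/-- The straight walk `0 → (s, 0)` is a diamond piece of span `s` (its interior points `(i, 0)`, `1 ≤ i < s`,
lie in both open wedges), so `x_c^s ≤ Σ_{n ≤ s} Σ_{DF[s, n]} x_c^n`. -/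
theorem doubling_straight_term (s : ℕ) :
    SAW.criticalFugacity ^ s ≤
      ∑ n ∈ Finset.range (s + 1), ∑ _ω ∈ DF[s, n], SAW.criticalFugacity ^ n := by
  have hval : ∀ i ≤ s, SAW.Zd.straightWalk 2 s i 0 = (i : ℤ) ∧ SAW.Zd.straightWalk 2 s i 1 = 0 := by
    intro i hi
    rw [show SAW.Zd.straightWalk 2 s i = Pi.single 0 (i : ℤ) by simp [SAW.Zd.straightWalk, min_eq_left hi]]
    simp only [Pi.single_eq_same, Pi.single_eq_of_ne (show (1 : Fin 2) ≠ 0 by decide), and_self]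
  have hmem : SAW.Zd.straightWalk 2 s ∈ DF[s, s] := by
    rw [Finset.mem_filter]
    refine ⟨SAW.Zd.straightWalk_mem_saws 2 s, (hval s le_rfl).1, (hval s le_rfl).2, fun i h1 h2 => ?_,
      fun i hi => ?_⟩
    · rw [(hval i h2.le).1, (hval i h2.le).2, abs_zero]
      exact ⟨by omega, by omega⟩
    · rw [(hval i hi).2, abs_zero, mul_zero]
      exact Nat.cast_nonneg s
  calc SAW.criticalFugacity ^ s ≤ ∑ _ω ∈ DF[s, s], SAW.criticalFugacity ^ s :=
        Finset.single_le_sum (f := fun _ => SAW.criticalFugacity ^ s)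
          (fun _ _ => pow_nonneg SAW.criticalFugacity_pos.le s) hmem
    _ ≤ ∑ n ∈ Finset.range (s + 1), ∑ _ω ∈ DF[s, n], SAW.criticalFugacity ^ n :=
        Finset.single_le_sum (f := fun n => ∑ _ω ∈ DF[s, n], SAW.criticalFugacity ^ n)
          (fun n _ => Finset.sum_nonneg fun _ _ => pow_nonneg SAW.criticalFugacity_pos.le n)
          (Finset.mem_range.2 (Nat.lt_succ_self s))

/-- **S2 `stub_doublingUpgrade` — DOUBLING UPGRADE: wedge-slab floor ⇒ pointwise diamond-piece floor**
(Madras–Slade 1993, Lemma 4.1.12, reflect-and-Schwarz, applied once to the wedge-bridge family).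
If for some `C ≥ 0`, `c > 0` and every span `l ≥ 1` the `x_c`-mass of wedge bridges of span `l` (some partial
sum in the length) is `≥ c l^{−C}`, then for every span `s ≥ 1` the `x_c`-mass of diamond pieces `0 → (s, 0)`
is `≥ c' s^{−C'}` with `C' = 2C + 1`, `c' = x_c² (min c 1)² / 4`; cut-off `2 N_l + 2` for `s = 2l + 1 + ε ≥ 3`
(resp. `s` for `s ≤ 2`, the straight walk); `x_c ≤ 1` because `μ ≥ 1`. -/
theorem stub_doublingUpgrade :
    (∃ C c : ℝ, 0 ≤ C ∧ 0 < c ∧ ∀ l : ℕ, 1 ≤ l → ∃ N : ℕ,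
      c * (l : ℝ) ^ (-C) ≤
        ∑ n ∈ Finset.range (N + 1),
          ∑ _ω ∈ (SAW.Zd.saws 2 n).filter (fun ω =>
              ω n 0 = (l : ℤ) ∧
              (∀ i, 1 ≤ i → i ≤ n → |ω i 1| < ω i 0 ∧ ω i 0 ≤ (l : ℤ)) ∧
              (∀ i ≤ n, 5 * |ω i 1| ≤ (l : ℤ))),
            SAW.criticalFugacity ^ n) →
    ∃ C c : ℝ, 0 ≤ C ∧ 0 < c ∧ ∀ s : ℕ, 1 ≤ s → ∃ N : ℕ,
      c * (s : ℝ) ^ (-C) ≤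
        ∑ n ∈ Finset.range (N + 1),
          ∑ _ω ∈ (SAW.Zd.saws 2 n).filter (fun ω =>
              ω n 0 = (s : ℤ) ∧ ω n 1 = 0 ∧
              (∀ i, 1 ≤ i → i < n → |ω i 1| < ω i 0 ∧ |ω i 1| < (s : ℤ) - ω i 0) ∧
              (∀ i ≤ n, 10 * |ω i 1| ≤ (s : ℤ))),
            SAW.criticalFugacity ^ n := by
  rintro ⟨C, c, hC, hc, hwedge⟩
  have hx0 : 0 < SAW.criticalFugacity := SAW.criticalFugacity_pos
  have hx1 : SAW.criticalFugacity ≤ 1 :=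
    inv_le_one_of_one_le₀ (SAW.Zd.connectiveConstant_two ▸ SAW.Zd.one_le_connectiveConstant 2)
  have hc₁0 : 0 < min c 1 := lt_min hc one_pos
  refine ⟨2 * C + 1, SAW.criticalFugacity ^ 2 * (min c 1) ^ 2 / 4, by linarith, by positivity,
    fun s hs => ?_⟩
  obtain ⟨l, ε, hε, rfl⟩ : ∃ l ε : ℕ, ε ≤ 1 ∧ s = 2 * l + 1 + ε :=
    ⟨(s - 1) / 2, (s - 1) % 2, by omega, by omega⟩
  rcases Nat.eq_zero_or_pos l with rfl | hl
  · refine ⟨2 * 0 + 1 + ε, le_trans ?_ (doubling_straight_term _)⟩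
    calc SAW.criticalFugacity ^ 2 * min c 1 ^ 2 / 4 * ((2 * 0 + 1 + ε : ℕ) : ℝ) ^ (-(2 * C + 1))
        ≤ SAW.criticalFugacity ^ 2 * min c 1 ^ 2 / 4 :=
          mul_le_of_le_one_right (by positivity) (Real.rpow_le_one_of_one_le_of_nonpos
            (by exact_mod_cast (show 1 ≤ 2 * 0 + 1 + ε by omega)) (by linarith))
      _ ≤ SAW.criticalFugacity ^ 2 := by
          nlinarith [pow_pos hx0 2, pow_le_one₀ (n := 2) hc₁0.le (min_le_right c 1)]
      _ ≤ _ := pow_le_pow_of_le_one hx0.le hx1 (by omega)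
  · obtain ⟨N, hN⟩ := hwedge l hl
    have hT0 : 0 ≤ ∑ n ∈ Finset.range (2 * N + 2 + 1), ∑ _ω ∈ DF[2 * l + 1 + ε, n],
        SAW.criticalFugacity ^ n :=
      Finset.sum_nonneg fun n _ => Finset.sum_nonneg fun _ _ => pow_nonneg hx0.le n
    have hpair := doubling_mass_pairing (l := l) hε rfl N
    have h2 := mirrorPin_final_algebra
      (T := 2 * ∑ n ∈ Finset.range (2 * N + 2 + 1), ∑ _ω ∈ DF[2 * l + 1 + ε, n], SAW.criticalFugacity ^ n)
      hx0 hx1 hc₁0 (min_le_left c 1) hC hl hε rfl hN (hpair.trans (by nlinarith [hT0])) (by positivity)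
    exact ⟨2 * N + 2, by linarith⟩

end Summit.CriticalPhenomena.SAWScalingLimit.Theorems.TubeLowerBound.BridgeDoublingTower

end
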